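import Summits.ResolutionOfSingularities.ResolutionOfSingularities.Theorems.RadicialJungCleanModelsCleanSpreadsDualDerivations
import Literature.AlgebraicGeometry.Resolution.DerivativeIdealsLocalization
import Literature.AlgebraicGeometry.Resolution.HilbertSamuelGenericConstancy
import HarnessLib

/-!
# Route `RadicialJung`, crux `CleanModels` (stmt-15917): DUAL DERIVATIONS ON A BASIC OPEN — brick B3, piece (S1d)
# of `HOME/L/res-L0-w81-pv-2/g5/S1-SPEC.md`

Support file (OURS) for PROGRAMME-clean-dim2 / T2 (`HOME/L/res-L0-w81-pv-2/g5/T2-ARCHITECTURE.md`, brick **B3**, chart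
construction (S1)); seat res-L1-s42-pv-2 g7 (res-plan-2 IDLE POOL DEAL #64/#65, piece (S1d)); line `via-clean-models` of
the crux `DescentPerfectToAll` (stmt-0549).  Nothing here is a statement of Hironaka's manuscript.  AI-written; AI review
weaker than expert review.

The finiteness of the Giraud-singular set (`finite_setOf_isGiraudSingularPoint_of_charts`, FILE 5) wants, on every chart
`U = Spec A` of the cover, global derivations `δ_j ∈ Der_ℤ(A)` DUAL to the boundary equations `x_j`: `δ_j x_l = [j = l]`.
`exists_derivations_dual_of_finiteType` (res-L0-w81-pv-2, `…CleanSpreadsDualDerivations`) produces, for a domain `B` of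
finite type over a field and a maximal `𝔮₀` with `B_{𝔮₀}` regular, derivations `E_j ∈ Der_ℤ(B)` with `E_j a_l = e·[j = l]`
for some `e ∉ 𝔮₀` — dual only up to the factor `e`.  This file inverts `e`:

* `exists_dual_derivations_of_isLocalization` — pure algebra: if `E_j a_l = e·[j = l]` on `B` and `e` becomes a unit in a
  localization `S = M⁻¹B`, then `S` carries derivations `δ_j` with `δ_j (a_l/1) = [j = l]` (extend `E_j` to `S` by
  `exists_derivation_extend_of_isLocalization` and multiply by `e⁻¹`); recorded with the extension formula
  (`exists_dual_derivations_of_isLocalization'`).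
* `exists_away_dual_derivations` — **(S1d)**: `∃ e ∉ 𝔮₀` such that EVERY localization of `B` away from `e` (any `S` with
  `IsLocalization.Away e S` — `Localization.Away e`, or `Γ(X, X.basicOpen e)` of an affine chart — with the generic
  `ℤ`-algebra structure `Ring.toIntAlgebra S` on which `Derivation ℤ S S` is stated throughout B3) carries dual derivations;
  the form at any prime `𝔭 ∌ e` is `exists_dual_derivations_atPrime`.
* `exists_basicOpen_dual_derivations` — the scheme dress: for an affine open `U` of a scheme `X` whose section ring is a
  domain of finite type over a field, a point `ξ₀ ∈ U` closed in `X` with regular stalk, and sections `a_j ∈ Γ(X, U)` whose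
  germs form a regular system of parameters at `ξ₀`, there is `e ∈ Γ(X, U)` with `ξ₀ ∈ X.basicOpen e` and derivations of
  `Γ(X, X.basicOpen e)` dual to the restrictions of the `a_j` (`IsAffineOpen.isLocalization_basicOpen`,
  `IsAffineOpen.isLocalization_stalk`, `IsAffineOpen.primeIdealOf_isMaximal_of_isClosed`, and the tree's
  `Literature.AlgebraicGeometry.Resolution.not_mem_primeIdealOf_iff_mem_basicOpen`).
-/

set_option linter.dupNamespace false -- mandated namespace of this single-conjunct summit

open IsLocalRing Literature.AlgebraicGeometry.Resolution AlgebraicGeometry CategoryTheory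

namespace Summit.ResolutionOfSingularities.ResolutionOfSingularities.Theorems.RadicialJung.CleanModels

universe u v

section Algebra

/-- **Dual derivations on a localization inverting the defect `e`**, with the extension formula: if `E_j a_l = e·[j = l]`
on `B` and `e` is a unit of the localization `S = M⁻¹B`, then there are `c ∈ S` with `c·e = 1` and derivations `δ_j` of
`S` with `δ_j (b/1) = c · (E_j b)/1` for all `b ∈ B`; in particular `δ_j (a_l/1) = [j = l]`. -/
theorem exists_dual_derivations_of_isLocalization' {B : Type u} [CommRing B] {d : ℕ} {a : Fin d → B}
    {E : Fin d → Derivation ℤ B B} {e : B} (hE : ∀ j l, E j (a l) = if j = l then e else 0)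
    (S : Type v) [CommRing S] [Algebra B S] (M : Submonoid B) [IsLocalization M S]
    (he : IsUnit (algebraMap B S e)) :
    ∃ (c : S) (δ : Fin d → Derivation ℤ S S), c * algebraMap B S e = 1 ∧
      (∀ j b, δ j (algebraMap B S b) = c * algebraMap B S (E j b)) ∧
      ∀ j l, δ j (algebraMap B S (a l)) = if j = l then 1 else 0 := by
  obtain ⟨c, hc⟩ := he.exists_left_inv
  have hext : ∀ j, ∃ D' : Derivation ℤ S S, ∀ b : B, D' (algebraMap B S b) = algebraMap B S (E j b) :=
    fun j => exists_derivation_extend_of_isLocalization ℤ S M (E j)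
  choose D hD using hext
  refine ⟨c, fun j => c • D j, hc, fun j b => ?_, fun j l => ?_⟩
  · rw [Derivation.smul_apply, hD, smul_eq_mul]
  · rw [Derivation.smul_apply, hD, hE, smul_eq_mul]
    split_ifs with h
    · exact hc
    · rw [map_zero, mul_zero]

/-- **Dual derivations on a localization inverting the defect `e`**: if `E_j a_l = e·[j = l]` on `B` and `e` is a unit
of the localization `S = M⁻¹B`, then `S` carries derivations `δ_j` with `δ_j (a_l/1) = [j = l]`. -/
theorem exists_dual_derivations_of_isLocalization {B : Type u} [CommRing B] {d : ℕ} {a : Fin d → B}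
    {E : Fin d → Derivation ℤ B B} {e : B} (hE : ∀ j l, E j (a l) = if j = l then e else 0)
    (S : Type v) [CommRing S] [Algebra B S] (M : Submonoid B) [IsLocalization M S]
    (he : IsUnit (algebraMap B S e)) :
    ∃ δ : Fin d → Derivation ℤ S S, ∀ j l, δ j (algebraMap B S (a l)) = if j = l then 1 else 0 := by
  obtain ⟨_, δ, _, _, hδ⟩ := exists_dual_derivations_of_isLocalization' hE S M he
  exact ⟨δ, hδ⟩

/-- **(S1d) Dual derivations away from a single element.** Let `B` be a domain of finite type over a field `k`, `𝔮₀` a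
maximal ideal with `B_{𝔮₀}` (`= O`) regular of dimension `d`, and `a_1, …, a_d ∈ B` mapping to a regular system of
parameters of `O`.  Then there is `e ∉ 𝔮₀` such that every localization `S` of `B` away from `e` carries derivations
`δ_1, …, δ_d ∈ Der_ℤ(S)` with `δ_j (a_l/1) = [j = l]`. -/
theorem exists_away_dual_derivations (k : Type u) [Field k] {B : Type u} [CommRing B] [IsDomain B] [Algebra k B]
    [Algebra.FiniteType k B] (𝔮₀ : Ideal B) [𝔮₀.IsMaximal] (O : Type v) [CommRing O] [Algebra B O]
    [IsLocalization.AtPrime O 𝔮₀] [IsRegularLocalRing O] {d : ℕ} (a : Fin d → B)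
    (ha : Ideal.span (Set.range fun i => algebraMap B O (a i)) = maximalIdeal O) (hd : ringKrullDim O = d) :
    ∃ e : B, e ∉ 𝔮₀ ∧ ∀ (S : Type u) [CommRing S] [Algebra B S] [IsLocalization.Away e S],
      ∃ δ : Fin d → Derivation ℤ S S, ∀ j l, δ j (algebraMap B S (a l)) = if j = l then 1 else 0 := by
  obtain ⟨E, e, he, hE⟩ := exists_derivations_dual_of_finiteType k 𝔮₀ O a ha hd
  refine ⟨e, he, fun S _ _ _ => ?_⟩
  exact exists_dual_derivations_of_isLocalization hE S (Submonoid.powers e)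
    (IsLocalization.Away.algebraMap_isUnit e)

/-- **(S1d) at a prime not containing `e`**: with `e` as in `exists_away_dual_derivations` (here: any `e` for which
`B` carries derivations `E_j` with `E_j a_l = e·[j = l]`), every localization of `B` at a prime `𝔭 ∌ e` — e.g. the stalk
of an affine chart at a point of `D(e)` — carries dual derivations. -/
theorem exists_dual_derivations_atPrime {B : Type u} [CommRing B] {d : ℕ} {a : Fin d → B}
    {E : Fin d → Derivation ℤ B B} {e : B} (hE : ∀ j l, E j (a l) = if j = l then e else 0)
    (𝔭 : Ideal B) [𝔭.IsPrime] (he : e ∉ 𝔭) (S : Type v) [CommRing S] [Algebra B S] [IsLocalization.AtPrime S 𝔭] :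
    ∃ δ : Fin d → Derivation ℤ S S, ∀ j l, δ j (algebraMap B S (a l)) = if j = l then 1 else 0 :=
  exists_dual_derivations_of_isLocalization hE S 𝔭.primeCompl
    (IsLocalization.map_units S (⟨e, he⟩ : 𝔭.primeCompl))

/-- The defect-`e` form itself, packaged with the unit statement: `∃ e ∉ 𝔮₀` and `E_j ∈ Der_ℤ(B)` with
`E_j a_l = e·[j = l]` — a restatement of `exists_derivations_dual_of_finiteType` in the order `(e, E)` convenient for
`exists_dual_derivations_of_isLocalization` / `exists_dual_derivations_atPrime`. -/
theorem exists_defect_dual_derivations (k : Type u) [Field k] {B : Type u} [CommRing B] [IsDomain B] [Algebra k B]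
    [Algebra.FiniteType k B] (𝔮₀ : Ideal B) [𝔮₀.IsMaximal] (O : Type v) [CommRing O] [Algebra B O]
    [IsLocalization.AtPrime O 𝔮₀] [IsRegularLocalRing O] {d : ℕ} (a : Fin d → B)
    (ha : Ideal.span (Set.range fun i => algebraMap B O (a i)) = maximalIdeal O) (hd : ringKrullDim O = d) :
    ∃ e : B, e ∉ 𝔮₀ ∧ ∃ E : Fin d → Derivation ℤ B B, ∀ j l, E j (a l) = if j = l then e else 0 := by
  obtain ⟨E, e, he, hE⟩ := exists_derivations_dual_of_finiteType k 𝔮₀ O a ha hd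
  exact ⟨e, he, E, hE⟩

end Algebra

section Scheme

variable {X : Scheme.{u}} {U : X.Opens} (hU : IsAffineOpen U)

include hU in
/-- **(S1d) on a chart.** Let `U` be an affine open of a scheme `X` whose ring of sections is a domain of finite type over
a field `k`, `ξ₀ ∈ U` a point closed in `X` with regular stalk `𝒪_{X,ξ₀}` of dimension `d`, and `a_1, …, a_d ∈ Γ(X, U)`
sections whose germs generate the maximal ideal of `𝒪_{X,ξ₀}`.  Then there is `e ∈ Γ(X, U)` with `ξ₀ ∈ X.basicOpen e`
and derivations `δ_1, …, δ_d ∈ Der_ℤ Γ(X, X.basicOpen e)` dual to the restrictions of the `a_j`: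
`δ_j (a_l|_{D(e)}) = [j = l]` (the restriction `Γ(X, U) → Γ(X, X.basicOpen e)` is `algebraMap`). -/
theorem exists_basicOpen_dual_derivations (k : Type u) [Field k] [Algebra k Γ(X, U)] [Algebra.FiniteType k Γ(X, U)]
    [IsDomain Γ(X, U)] {ξ₀ : X} (hξ₀ : ξ₀ ∈ U) (hcl : IsClosed ({ξ₀} : Set X))
    (hreg : IsRegularLocalRing (X.presheaf.stalk ξ₀)) {d : ℕ} (a : Fin d → Γ(X, U))
    (ha : Ideal.span (Set.range fun i => X.presheaf.germ U ξ₀ hξ₀ (a i)) = maximalIdeal (X.presheaf.stalk ξ₀))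
    (hd : ringKrullDim (X.presheaf.stalk ξ₀) = d) :
    ∃ e : Γ(X, U), ξ₀ ∈ X.basicOpen e ∧
      ∃ δ : Fin d → Derivation ℤ Γ(X, X.basicOpen e) Γ(X, X.basicOpen e),
        ∀ j l, δ j (algebraMap Γ(X, U) Γ(X, X.basicOpen e) (a l)) = if j = l then 1 else 0 := by
  letI : Algebra Γ(X, U) (X.presheaf.stalk ξ₀) := X.presheaf.algebra_section_stalk (⟨ξ₀, hξ₀⟩ : (U : X.Opens))
  haveI : IsLocalization.AtPrime (X.presheaf.stalk ξ₀) (hU.primeIdealOf ⟨ξ₀, hξ₀⟩).asIdeal :=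
    hU.isLocalization_stalk ⟨ξ₀, hξ₀⟩
  haveI : (hU.primeIdealOf ⟨ξ₀, hξ₀⟩).asIdeal.IsMaximal := hU.primeIdealOf_isMaximal_of_isClosed ⟨ξ₀, hξ₀⟩ hcl
  have halg : algebraMap Γ(X, U) (X.presheaf.stalk ξ₀) = (X.presheaf.germ U ξ₀ hξ₀).hom :=
    TopCat.Presheaf.stalk_open_algebraMap X.presheaf ⟨ξ₀, hξ₀⟩
  have ha' : Ideal.span (Set.range fun i => algebraMap Γ(X, U) (X.presheaf.stalk ξ₀) (a i)) =
      maximalIdeal (X.presheaf.stalk ξ₀) := by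
    rw [halg]; exact ha
  obtain ⟨e, he, h⟩ := exists_away_dual_derivations k (hU.primeIdealOf ⟨ξ₀, hξ₀⟩).asIdeal
    (X.presheaf.stalk ξ₀) a ha' hd
  haveI : IsLocalization.Away e Γ(X, X.basicOpen e) := hU.isLocalization_basicOpen e
  exact ⟨e, (not_mem_primeIdealOf_iff_mem_basicOpen hU hξ₀ e).mp he, h Γ(X, X.basicOpen e)⟩

/-- The restriction map `Γ(X, U) → Γ(X, X.basicOpen e)` IS the `algebraMap` of `exists_basicOpen_dual_derivations`. -/
theorem algebraMap_basicOpen_eq (e : Γ(X, U)) :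
    algebraMap Γ(X, U) Γ(X, X.basicOpen e) = (X.presheaf.map (homOfLE (X.basicOpen_le e)).op).hom := rfl

end Scheme

end Summit.ResolutionOfSingularities.ResolutionOfSingularities.Theorems.RadicialJung.CleanModels
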